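import Literature.Probability.LatticeModels.SharpLengthDCPTorus
import Literature.Probability.LatticeModels.CriticalTwoPointDCPLowerLemma25
import Literature.Probability.LatticeModels.IsingBubbleDivergenceProofs
import Literature.Probability.LatticeModels.CriticalEtaUpperDCPProofs
import HarnessLib

/-!
# Duminil-Copin–Panis 2025, Theorem 1.2 at `β_c`: discharge of the named fact
# `dcp_reflectedGradient_lower` (assembly of the tree's torus route)

Topic `Literature/Probability/LatticeModels`; family `crit-ising`. Theorem-only file (no definition,
no named fact). It closes the tree's route to
`Literature.Probability.LatticeModels.dcp_reflectedGradient_lower` (Duminil-Copin–Panis, CMP 406 (2025),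
arXiv:2404.05700, **Theorem 1.2** at `β = β_c`; `CriticalTwoPointDCPLower.lean`):

* `ReflectedCurrents.lean` — fold data, the switching lemma for reflected currents (Lemma 2.3);
* `TorusFoldable.lean`, `CriticalTwoPointDCPLowerTorus.lean` — the reflections of an even torus are
  fold data; the pointwise inequality (2.20)–(2.24); Lemma 2.4 in current form;
* `CriticalTwoPointDCPLowerLemma25.lean` — **Lemma 2.5** for an abstract fold datum (`IsFoldable.lemma25`);
* `SharpLengthDCPTorus.lean` — integration on the even tori, the limit `L → ∞`, the symmetry over the
  `2d` directions and Lemma 2.4 proper, giving Theorems 1.2–1.3 for `β ≤ β_c` **modulo the per-pair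
  torus form `H25` of Lemma 2.5** (`DCPNearCritical.dcp_critical_of_lemma25`).

The only work done here is the instantiation `H25 ⇐ IsFoldable.lemma25` on the torus fold datum of a
direction `δ` (`DCPLower.isFoldable_dir`) with candidate region `B = Λ̄_n` (the image of the box):
box points are in the strict half `H_δ` or on the hyperplane (`DCPLower.proj_mem_dirHalf_or_fixed`);
for `x̄` on the hyperplane the event `x̄ ↮ ℍ_δ` is empty (`IsFoldable.connFix_of_fixed`), so that
summand vanishes, and otherwise Lemma 2.5 applies verbatim (`Finset.filter_image` identifies the two
writings of the random volume `𝒮¹_n`).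

Also, as corollaries of the two discharges: Theorem 1.5 (`dcp_isingEta_le_half_holds`, through the
tree's printed reduction `dcp_isingEta_le_half_of_axis_lower`, `CriticalEtaUpperDCPProofs.lean`) and the
failure of the bubble condition on `ℤ³` and `ℤ⁴` (`not_bubbleCondition_three_and_four`, through
`not_bubbleCondition_of_reflectedGradient_lower`, `IsingBubbleDivergenceProofs.lean`, where Theorem 1.8
itself, `DuminilCopinPanis2025_bubbleDiagram_eq_top_holds`, is discharged next to its reduction).

## References

* H. Duminil-Copin, R. Panis, *New lower bounds for the (near) critical Ising and φ⁴ models' two-point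
  functions*, Comm. Math. Phys. 406 (2025), arXiv:2404.05700, Theorem 1.2 and §2.2 (Lemmas 2.3–2.5,
  eqs. (2.20)–(2.24)) [DuminilCopinPanis2025LowerBounds] (held: `lit read arxiv:2404.05700`, pp. 3–5, 8–11).
-/

noncomputable section

open Finset

namespace Literature.Probability.LatticeModels

namespace DCPLower

variable {d : ℕ}

open Classical in
open scoped ENNReal symmDiff in
/-- **Lemma 2.5 of Duminil-Copin–Panis 2025 on the even torus, per pair** — exactly the hypothesis
`H25` of `DCPLower.torusIneq_of_lemma25` / `DCPNearCritical.dcp_critical_of_lemma25`: for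
`0 ≤ β`, `n ≥ 1`, an even torus `(ℤ/Lℤ)^d` with `4n + 2 ≤ L`, a direction `δ` and box points
`x, y ∈ Λ_n`,
`∑_{∂𝐧=∅} w(𝐧) 𝟙[0̄, x̄ ∈ W_δ(𝐧), ȳ ↔ ℍ_δ] ⟨σ_{0̄}σ_{x̄}⟩_{W_δ(𝐧)} ≤ (Z^{{0̄,x̄}} - Z^{{0̄,θ_δ x̄}}) ⟨σ_ȳσ_{θ_δ ȳ}⟩_{𝕋_L}`,
`W_δ(𝐧) = {z̄ : z ∈ Λ_n, z̄ ↮_{ℳ_δ} ℍ_δ}`. It is `IsFoldable.lemma25` for the fold datum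
`isFoldable_dir` with `B = Λ̄_n` when `x̄` lies in the strict half `H_δ`; when `x̄` is on the
hyperplane it is joined to `ℍ_δ` by the empty path, the indicator vanishes and the left side is `0`.
(The hypotheses `β ≤ β_c` and `y ∼ x` of `H25` are not needed.) [cite: DuminilCopinPanis2025LowerBounds, Lemma 2.5] -/
theorem lemma25_torus (β : ℝ) (hβ : 0 ≤ β) (_hβc : β ≤ criticalBeta d) (n : ℕ) (hn : 1 ≤ n)
    (L : ℕ) [NeZero L] (hL : Even L) (hnL : 4 * n + 2 ≤ L)
    (δ : Fin d × Bool) (x : Site d) (hx : x ∈ box d n) (y : Site d) (hy : y ∈ box d n)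
    (_hxy : (zdGraph d).Adj x y) :
    ∑' nc : edgesIn (torusGraph d L) univ → ℕ,
        ind (csources (torusGraph d L) univ nc = ∅ ∧
            CSupp (torusGraph d L) univ (edgesIn (torusGraph d L) univ) nc) *
          cweight (torusGraph d L) univ β nc *
          (ind (¬ (isFoldable_dir hL (by omega) n δ).ConnFix ((isFoldable_dir hL (by omega) n δ).fold nc)
                  (Torus.proj L 0) ∧
                ¬ (isFoldable_dir hL (by omega) n δ).ConnFix ((isFoldable_dir hL (by omega) n δ).fold nc)
                  (Torus.proj L x) ∧
                (isFoldable_dir hL (by omega) n δ).ConnFix ((isFoldable_dir hL (by omega) n δ).fold nc)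
                  (Torus.proj L y)) *
            ENNReal.ofReal (isingTwoPoint (torusGraph d L)
              (((box d n).filter fun z => ¬ (isFoldable_dir hL (by omega) n δ).ConnFix
                  ((isFoldable_dir hL (by omega) n δ).fold nc) (Torus.proj L z)).image (Torus.proj L))
              β 0 .free (Torus.proj L 0) (Torus.proj L x))) ≤
      (currentZ (torusGraph d L) univ β (edgesIn (torusGraph d L) univ) ({Torus.proj L 0} ∆ {Torus.proj L x}) -
          currentZ (torusGraph d L) univ β (edgesIn (torusGraph d L) univ)
            ({Torus.proj L 0} ∆ {dirTheta L n δ (Torus.proj L x)})) *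
        ENNReal.ofReal (isingTwoPoint (torusGraph d L) univ β 0 .free (Torus.proj L y)
          (dirTheta L n δ (Torus.proj L y))) := by
  set h := isFoldable_dir (d := d) hL (by omega : 2 < L) n δ
  rcases proj_mem_dirHalf_or_fixed hL hnL hx δ with hxH | hxfix
  · -- `x̄ ∈ H_δ`: Lemma 2.5 with `B = Λ̄_n`
    have hBfix : ∀ v ∈ (box d n).image (Torus.proj L), v ∈ dirHalf L n δ ∨ dirTheta L n δ v = v := by
      intro v hv
      obtain ⟨z, hz, rfl⟩ := mem_image.1 hv
      exact proj_mem_dirHalf_or_fixed hL hnL hz δ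
    have key := h.lemma25 hβ (B := (box d n).image (Torus.proj L)) (subset_univ _) hBfix
      (proj_zero_mem_dirHalf hL hn hnL δ) hxH (mem_image_of_mem _ (zero_mem_box d n))
      (mem_image_of_mem _ hx) (mem_univ _) (proj_mem_dirHalf_or_fixed hL hnL hy δ)
    refine le_of_eq_of_le (tsum_congr fun nc => ?_) key
    rw [Finset.filter_image]
  · -- `x̄` on the hyperplane: `x̄ ↔ ℍ_δ` always, the indicator vanishes
    have hzero : ∀ nc : edgesIn (torusGraph d L) univ → ℕ,
        ind (¬ h.ConnFix (h.fold nc) (Torus.proj L 0) ∧ ¬ h.ConnFix (h.fold nc) (Torus.proj L x) ∧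
          h.ConnFix (h.fold nc) (Torus.proj L y)) = 0 := fun nc =>
      ind_of_false fun H => H.2.1 (h.connFix_of_fixed _ (mem_univ _) hxfix)
    simp only [hzero, zero_mul, mul_zero, tsum_zero, zero_le]

end DCPLower

variable {d : ℕ}

/-- **Duminil-Copin–Panis 2025, Theorem 1.2 at `β = β_c` (discharge of the named fact
`dcp_reflectedGradient_lower`).** Printed: "Let `d ≥ 3`. There exist `c₀, N₀ > 0` such that for all
`β ≤ β_c` and for all `N₀ ≤ n ≤ L(β)`,
`β Σ_{x,y ∈ Λ_n, y ∼ x} (⟨τ₀τ_x⟩_β - ⟨τ₀τ_{𝓡_n(x)}⟩_β) ⟨τ_yτ_{𝓡_n(y)}⟩_β ≥ c₀`"; here at `β_c`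
(`L(β_c) = ∞`). Proof: the tree's torus route (§2.2 of the source) modulo the per-pair torus form of
Lemma 2.5 (`DCPNearCritical.dcp_critical_of_lemma25`), fed with Lemma 2.5 (`DCPLower.lemma25_torus`,
from `IsFoldable.lemma25`). [cite: DuminilCopinPanis2025LowerBounds, Theorem 1.2] -/
theorem dcp_reflectedGradient_lower_holds : dcp_reflectedGradient_lower (d := d) :=
  (DCPNearCritical.dcp_critical_of_lemma25 (d := d) DCPLower.lemma25_torus).1

/-- **Duminil-Copin–Panis 2025, Theorem 1.3 at `β = β_c` (discharge of the named fact
`dcp_criticalTwoPoint_axis_lower`)**: "`⟨τ₀τ_{ne₁}⟩_β ≥ c₁ / (χ_{4n}(β) + n^{d-2} Σ_{k ≤ 2n} k⟨τ₀τ_{ke₁}⟩_β)`"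
for `n ≥ N₁`, from Theorem 1.2 (same assembly). [cite: DuminilCopinPanis2025LowerBounds, Theorem 1.3] -/
theorem dcp_criticalTwoPoint_axis_lower_holds : dcp_criticalTwoPoint_axis_lower (d := d) :=
  (DCPNearCritical.dcp_critical_of_lemma25 (d := d) DCPLower.lemma25_torus).2

/-- **Duminil-Copin–Panis 2025, Theorem 1.5 (discharge of the named fact `dcp_isingEta_le_half`).**
Printed (arXiv v1, p. 6): "Let `d = 3`. If the critical exponent `η` exists, it satisfies `η ≤ 1/2`.
*Proof.* The proof follows by plugging the estimate provided by the existence of `η` in (1.9)." — (1.9) is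
Theorem 1.3 at `β_c` (`dcp_criticalTwoPoint_axis_lower_holds` above) and the printed implication is the
tree's theorem `dcp_isingEta_le_half_of_axis_lower` (`CriticalEtaUpperDCPProofs.lean`).
[cite: DuminilCopinPanis2025LowerBounds, Theorem 1.5] -/
theorem dcp_isingEta_le_half_holds : dcp_isingEta_le_half :=
  dcp_isingEta_le_half_of_axis_lower (dcp_criticalTwoPoint_axis_lower_holds (d := 3))

open Literature.Barriers.CriticalPhenomena in
/-- **The bubble condition fails on `ℤ³` and on `ℤ⁴`** (Duminil-Copin–Panis 2025, Theorem 1.8 in the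
barrier vocabulary `NNIsing.BubbleCondition d := Σ_x ⟨σ₀σ_x⟩²_{β_c} < ∞`): Theorem 1.2 at `β_c`
(`dcp_reflectedGradient_lower_holds`) in `d = 3` and `d = 4`, through the printed proof of Theorem 1.8
(`not_bubbleCondition_of_reflectedGradient_lower`, `IsingBubbleDivergenceProofs.lean`).
[cite: DuminilCopinPanis2025LowerBounds, Theorem 1.8] -/
theorem not_bubbleCondition_three_and_four :
    ¬ NNIsing.BubbleCondition 3 ∧ ¬ NNIsing.BubbleCondition 4 :=
  ⟨not_bubbleCondition_of_reflectedGradient_lower (Or.inl rfl) (dcp_reflectedGradient_lower_holds (d := 3)),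
    not_bubbleCondition_of_reflectedGradient_lower (Or.inr rfl) (dcp_reflectedGradient_lower_holds (d := 4))⟩

end Literature.Probability.LatticeModels

end
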